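import Summits.CriticalPhenomena.PercolationContinuityZ3.Theorems.Transplant.SkelPhiConcFaceData
import Summits.CriticalPhenomena.PercolationContinuityZ3.Theorems.Transplant.SkelPhiFaceResidue
import Summits.CriticalPhenomena.PercolationContinuityZ3.Theorems.Transplant.SkelPhiConcSchedule
import Summits.CriticalPhenomena.PercolationContinuityZ3.Theorems.Transplant.SkelConcFaceObl
import HarnessLib

/-!
# D″ node, (F) part 4 at φ-level (DPRIME-SCOPE §2 L6′, hp-8 column): the FACE OBLIGATION `Skelφ.FaceOblAt` at the two-unit cell geometry of
# record MODULO THE PER-LEVEL KIT CLAUSE (scheme-parametric), the planar offset along a macro-edge, and target nonemptiness at a realised pair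
# — φ-level re-cut of `SkelConcFaceObl` §1 + the realised-radii devices of §2 (hp-8 g24, p235972) with `PCells ↦ PCells2`,
# `Skel.concRadiiS ↦ Skelφ.concRadii2S` (p2-g7), `Skel.FaceOblAt ↦ Skelφ.FaceOblAt`; the RUN form `faceOblR_concS` (which needs the φ-level
# `realised_of_choice_SG` / `tgt_add_stepVec_ne_zero` of p5-g6's `SkelPhiConcRealised`) goes to the closing file `SkelPhiConcFaceRun`

builds on p205010 (kernel theorem, internal audit signed; external expert review pending) — nothing in this file uses p205010.
Lane `prim-bschramm`, seat `prim-hp-8` (gen 30; L6′ (F) owner); helper file (`--supports stmt-CriticalPhenomena-4575`).  Hypotheses through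
p3-g7's dictionary (DPRIME-SCOPE addendum K): `hlip : Skelφ.Lip G φ`, `hstep : Skelφ.Steps G φ`; `P : PCells2`, `Λ : ConcRadiiG`, `hΛ : Skelφ.WFS2 P Λ`.
TWO-UNIT SIGNATURE CHANGES (forced): the transverse room `Rlev + 3 ≤ 3 r⊥` of `Skelφ.faceStepW_encl`, the planar diameter `50 rmax` of the
excess radius, the offset step `20 rmax`.
* §1 **`faceOblAt_concSG (hlip) (hstep)`** — for a valid history examining `x = tgt e` at anchors `(a, a')`, an onward `du`, `j + 1 ≤ K`, an
  observation `o`: the step `Skelφ.faceStepW` (part 3), the count inequality, the target cube `M_{a'}(x + du)` nonempty, `Rlev + 4 ≤ 10 s∥`,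
  `Rlev + 3 ≤ 3 r⊥`, an entrance depth `R₀ ≥ rQ_a(x), sup ρ_{a'}(x,du,·)`, an excess radius `R₁ ≤ rM_{a'}(x+du) − L'` at the running parameter
  (centre `w₀`, entrance depth `R₀ + 1`, planar diameter `50 rmax`), `η ≤ δc / 2`, and THE PER-LEVEL KIT CLAUSE for this step (hypothesis `hkits`,
  verbatim; discharged by p1-g9's `Skelφ.kitClause'` + the inner band chain in part 5) ⟹ `Skelφ.FaceOblAt G φ S (faceDataSG …) Δ' δ₂ h e a a' du j o`;
* §2 `PCells2.off2_add_stepVec_le` (`off2 (x + du) ≤ off2 x + 20 rmax`), **`M_succ_nonempty_real (hstep)`** (target nonemptiness at a realised pair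
  from `20 rmax + L' ≤ gap`, at the schedule of record `Skelφ.concRadii2S`).
[cite: KozmaNitzan2024, §4 p. 27 ((30)), p. 30 (Step III), Lemma 10 (p. 17), Lemma 12 (p. 24)] [cite: MartineauSevero2019, Cor. 2.2]
-/

noncomputable section

open MeasureTheory
open scoped Classical

namespace Summit.CriticalPhenomena.PercolationContinuityZ3.Theorems.Transplant

open Literature.Probability.Percolation Literature.Probability.LatticeModels SimpleGraph KNCells KNLevels GadgetSystem Contour
open Literature.Probability.Percolation.KozmaNitzan
open Literature.Probability.Percolation.KozmaNitzan.Cells (oth oth_ne sgOf sgOf_sign stepVec_apply_fst stepVec_apply_oth eq_oth_of_ne oth_oth)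
open Literature.Barriers.CriticalPhenomena (graphBall graphBall_finite mem_graphBall_self graphBall_mono)
open BoxProdZ2 (ConcRadiiG Erad Frad nQ nS Realised Frad_succ Frad_le_Erad)

/-! ## §2a Planar: the offset along a macro-edge, two units -/

namespace PCells2

/-- `off2 (x + du) ≤ off2 x + 20 rmax` (the centres move by `20 r_a ≤ 20 rmax` along a macro-edge of axis `a`). [folklore] -/
theorem off2_add_stepVec_le (P : PCells2) (x : Site 2) (du : MDir) : Skelφ.off2 P (x + stepVec du) ≤ Skelφ.off2 P x + 20 * P.rmax := by
  have key : ∀ i, (P.cen (x + stepVec du) i).natAbs ≤ (P.cen x i).natAbs + 20 * P.r i * (stepVec du i).natAbs := by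
    intro i
    have h : P.cen (x + stepVec du) i = P.cen x i + 20 * (P.r i : ℤ) * stepVec du i := by
      simp only [PCells2.cen_apply, Pi.add_apply]; ring
    rw [h]
    refine (Int.natAbs_add_le _ _).trans ?_
    have h2 : (20 * (P.r i : ℤ) * stepVec du i).natAbs = 20 * P.r i * (stepVec du i).natAbs := by
      rw [Int.natAbs_mul, Int.natAbs_mul]; simp
    rw [h2]
  have hst : (stepVec du 0).natAbs + (stepVec du 1).natAbs = 1 := by
    have hd : du.1 = 0 ∨ du.1 = 1 := by
      rcases du with ⟨i, b⟩
      fin_cases i <;> simp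
    have hs : (sgOf du).natAbs = 1 := by rcases sgOf_sign du with hσ | hσ <;> simp [hσ]
    have ha : stepVec du du.1 = sgOf du := stepVec_apply_fst du
    have hb : stepVec du (oth du.1) = 0 := stepVec_apply_oth du
    rcases hd with hd | hd
    · have ho : oth du.1 = 1 := by rw [hd]; rfl
      rw [hd] at ha; rw [ho] at hb; simp [ha, hb, hs]
    · have ho : oth du.1 = 0 := by rw [hd]; rfl
      rw [hd] at ha; rw [ho] at hb; simp [ha, hb, hs]
  have hr0 : P.r 0 ≤ P.rmax := P.r_le_rmax 0
  have hr1 : P.r 1 ≤ P.rmax := P.r_le_rmax 1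
  unfold Skelφ.off2
  have h0 := key 0
  have h1 := key 1
  have hb0 : (stepVec du 0).natAbs ≤ 1 := by omega
  have hb1 : (stepVec du 1).natAbs ≤ 1 := by omega
  have e0 : 20 * P.r 0 * (stepVec du 0).natAbs ≤ 20 * P.rmax * (stepVec du 0).natAbs :=
    Nat.mul_le_mul_right _ (Nat.mul_le_mul_left 20 hr0)
  have e1 : 20 * P.r 1 * (stepVec du 1).natAbs ≤ 20 * P.rmax * (stepVec du 1).natAbs :=
    Nat.mul_le_mul_right _ (Nat.mul_le_mul_left 20 hr1)
  have hsum : 20 * P.rmax * (stepVec du 0).natAbs + 20 * P.rmax * (stepVec du 1).natAbs = 20 * P.rmax := by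
    rw [← Nat.mul_add, hst, Nat.mul_one]
  omega

end PCells2

namespace Skelφ

open Skel (winGraph WinStepData excess)

variable {V : Type} [DecidableEq V] [Countable V] {G : SimpleGraph V} [G.LocallyFinite] {φ : V → Site 2}

/-! ## §1 `FaceOblAt` at the geometry of record, modulo the per-level kit clause -/

section AtGeometry

variable {P : PCells2} {w₀ : V} {Λ : ConcRadiiG} {S : KSchA V ℕ}
variable (hΓ : S.Γ = cellGeomSG G φ P w₀ Λ) (hΛ : WFS2 P Λ)
variable {h : ProbeHistory V} {e : Site 2 × MDir} (hV : S.Valid₂ G h e) {a a' : ℕ} {du : MDir} (hdu : du ∈ S.onward G h (tgt e))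
variable {j : ℕ} {o : Finset (Sym2 V)}

include hΓ hΛ hV hdu

/-- **`FaceOblAt` for the two-unit cell geometry of record, modulo the per-level kit clause** (from `Lip`, `Steps`).  The step is
`Skelφ.faceStepW` (window depth `rE_{a'}(x,du)`, region over the shrunk far rows, target `M_{a'}(x+du) ∪ Rim`, levels `[M+1, Rlev]`, source the
root, support `Sx`); every non-kit clause is discharged by parts 1–3; the rim excess by `rim_excess_faceStepW` (φ-level form of
`Skel.faceOblAt_concSG`). [cite: KozmaNitzan2024, §4 p. 30 (Step III), Lemma 10 (p. 17), Lemma 12 (p. 24)] -/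
theorem faceOblAt_concSG (hlip : Lip G φ) (hstep : Steps G φ) (hjK : j + 1 ≤ P.K) {Δ' Rlev N M L' : ℕ} {δ₂ : ℝ}
    (hRlev : Rlev + 4 ≤ 10 * P.s du.1) (hRlev' : Rlev + 3 ≤ 3 * P.r (oth du.1))
    (hcount : 1 / (1 - (S.p : ℝ)) ^ (Δ' * N) ≤ δ₂ * ((Finset.Icc (M + 1) Rlev).card : ℝ))
    (hMne : (S.Γ.M a' (tgt e + stepVec du)).Nonempty)
    (hkits : let Q := faceStepW G φ P w₀ Λ a' (tgt e) du j Rlev N M L' (S.Sx G h e a a' du)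
      ∀ j' ∈ Finset.Icc Q.j₀ Q.j₁, ∃ (σ : KNLevels.SData V) (Sz : Finset V),
        KNLevels.SHyp (winLData G φ Q.root Q.Rπ Q.lo Q.hi Q.root Q.Sfin) j' σ ∧ σ.N ≤ Q.N ∧
        (1 - (S.p : ℝ) ^ σ.sB) ^ σ.k ≤ δ₂ ∧ Sz ⊆ (winLData G φ Q.root Q.Rπ Q.lo Q.hi Q.root Q.Sfin).X j' ∧ Sz ⊆ stepRg G φ Q ∧
        (∀ x ∈ σ.K, ∀ e' ∈ σ.seed x, e' ∉ wireSet (↑Sz : Set V)) ∧ (∀ x ∈ σ.K, σ.face x ⊆ Sz) ∧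
        (∀ x ∈ σ.K, 1 - 3 * δ₂ ≤ (prodBernoulli (S.Wt G h e a a' du j o)).real {ω | ∃ u ∈ σ.face x,
          1 - δ₂ < (prodBernoulli (pinW (S.Wt G h e a a' du j o) (wireSet (↑Sz : Set V)) ω)).real
            (⋃ t ∈ Q.T, openConnIn (↑(stepRg G φ Q) : Set V) u t)}))
    {R₀ : ℕ} (hQ : Λ.rQ a (tgt e) ≤ R₀) (hρ : ∀ ℓ, Λ.ρ a' (tgt e) du ℓ ≤ R₀) {η : ℝ} (hη : η ≤ S.δc / 2) {R₁ : ℕ}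
    (hR₁ : ∀ R', R₁ ≤ R' → ∀ (Rw : ℕ) (D' A' : Finset V), (∀ d ∈ D', d ∈ graphBall G w₀ Rw) →
      (∀ d ∈ D', ∀ d' ∈ D', φ d - φ d' ∈ box 2 (50 * P.rmax)) → A' ⊆ D' → (∀ a ∈ A', a ∈ graphBall G w₀ (R₀ + 1)) →
        (bondPercolation G S.p).real (excess G w₀ R' D' A') ≤ η)
    (hR : R₁ ≤ Λ.rM a' (tgt e + stepVec du) - L') :
    FaceOblAt G φ S (faceDataSG G φ P w₀ Λ) Δ' δ₂ h e a a' du j o := by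
  have hexc := rim_excess_faceStepW hΓ hΛ hV hdu (j := j) (o := o) Rlev N M L' hlip hstep hQ hρ hR₁ hR
  have hsub := isSubbox_faceStepW hΓ hΛ hV hdu (a := a) (a' := a') (j := j) (o := o) Rlev N M L' hlip hstep
  have hRgS := faceStepW_Rg_subset_Sfin hΓ hΛ (h := h) (e := e) (a := a) (a' := a') (du := du) (j := j) Rlev N M L' hlip hstep
  have hroot := faceStepW_root_eq hΓ (h := h) (e := e) (a := a) (a' := a') (du := du) (j := j) Rlev N M L'
  have ho := root_not_mem_faceStepW_Rg hΓ hΛ hV hdu (a := a) (a' := a') (j := j) Rlev N M L' hlip hstep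
  have hoS := root_mem_faceStepW_Sfin (φ := φ) hV (P := P) (w₀ := w₀) (Λ := Λ) (a := a) (a' := a') (du := du) (j := j) Rlev N M L'
  obtain ⟨Γ, p, δc⟩ := S
  cases hΓ
  refine ⟨faceStepW G φ P w₀ Λ a' (tgt e) du j Rlev N M L' (KSchA.Sx G ⟨cellGeomSG G φ P w₀ Λ, p, δc⟩ h e a a' du),
    (cellGeomSG G φ P w₀ Λ).M a' (tgt e + stepVec du), η, hroot, hsub, finSupp_faceStepW Rlev N M L', hRgS,
    faceStepW_encl G φ P w₀ Λ a' (tgt e) du hjK hRlev hRlev' N M L' _, ho, hoS, le_rfl,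
    faceStepW_T_subset_Rg G φ w₀ a' (tgt e) du Rlev N M L' _ hΛ.toWF2 (by omega),
    faceStepW_T_nonempty G φ P w₀ Λ a' (tgt e) du j Rlev N M L' _ hMne,
    hcount, hkits, Finset.subset_union_left, subset_rfl, hexc, hη, ?_⟩
  exact Face_subset_faceStepW_X_zero G φ w₀ a' (tgt e) du j Rlev N M L' _ hΛ.toWF2

end AtGeometry

/-! ## §2b Target nonemptiness at a realised pair, at the schedule of record -/

section Realised

variable (P : PCells2) (w₀ : V) (gap gap' : ℕ → ℕ) (E₀ L' : ℕ)

omit [Countable V] in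
/-- **The true target of a realised pair is nonempty** (from `Steps`): at a chosen edge with `g = nQ (aOf₁) x` and `‖x‖₁ ≤ g`, the target cube
radius `rM_{a'}(x + du) = E g + gap (E g) − L'` dominates `off2 (x + du) ≤ E g + 20 rmax` once `20 rmax + L' ≤ gap (E g)`; then (ι) puts a
vertex over `cen (x + du)` into `M_{a'}(x + du)` (φ-level form of `Skel.M_succ_nonempty_real`). [cite: KozmaNitzan2024, §4 p. 26 ((29))] -/
theorem M_succ_nonempty_real (hstep : Steps G φ) (hgap : ∀ n, 20 * P.rmax ≤ gap n) (hE₀ : 1 ≤ E₀) (hφ : φ w₀ = 0) {α β : ℕ} {x : Site 2}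
    {du : MDir} (hr : Realised α β x) (hy : x + stepVec du ≠ 0) (hx : (x 0).natAbs + (x 1).natAbs ≤ nQ α x)
    (hgapL : 20 * P.rmax + L' ≤ gap (Erad gap gap' E₀ (nQ α x))) :
    ((cellGeomSG G φ P w₀ (concRadii2S P gap gap' E₀ L')).M β (x + stepVec du)).Nonempty := by
  refine M_nonempty_of_offset_le P w₀ hstep (x + stepVec du) ?_
  simp only [hφ, Pi.zero_apply, sub_zero]
  change off2 P (x + stepVec du) ≤ Frad gap gap' E₀ (nQ β (x + stepVec du)) - L'
  rw [hr.nQ_add_stepVec hy, Frad_succ]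
  have h1 := PCells2.off2_add_stepVec_le P x du
  have h2 := off2_le_Erad P gap' E₀ hgap hE₀ hx (gap := gap)
  omega

end Realised

end Skelφ

end Summit.CriticalPhenomena.PercolationContinuityZ3.Theorems.Transplant

end
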